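import Literature.AlgebraicGeometry.Motives.CurveThroughTwoPointsSeparated
import Mathlib.RingTheory.AdjoinRoot
import HarnessLib

/-!
# Two charts of a (possibly non-separated) scheme map a smooth curve through two points

Topic `Literature/AlgebraicGeometry/Motives` (family `hodge`). PROOF FILE (theorems only; no
definition, no named fact). This is the gluing step of Mumford's two-point lemma (*Abelian
Varieties*, §6, Lemma: "Any two points of an irreducible variety lie on an irreducible curve") for
ambient `ℂ`-schemes which are NOT assumed separated — the case listed under "What is still NOT here"
in `Motives/CurveThroughTwoPointsSeparated`. The printed lemma and its tree forms
(`mumford_smoothCurve_through_two_points_holds`, affine; `…_of_isSeparated`, separated, via Chow's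
lemma) do not apply to a non-separated `X` directly, and no proper surjection from a separated scheme
onto a non-separated one exists. The device of this file: two CHARTS of `X` over a common affine
integral base are glued, after an auxiliary integral base change, along a basic open on which they
agree, to a morphism from a SEPARATED integral scheme, to which the separated lemma applies.

* `TwoCharts.exists_isSeparated_through_two_charts` — let `T` be an affine integral `ℂ`-scheme of
  finite type, `A, B ⊆ T` opens, `O ⊆ A ∩ B` a non-empty open, `α : A → X`, `β : B → X` two
  `ℂ`-morphisms agreeing on `O`, and `z_a ∈ A(ℂ)`, `z_b ∈ B(ℂ)`. Then some integral separated
  `ℂ`-scheme `S` of finite type maps to `X` through `α(z_a)` and `β(z_b)` at two DISTINCT complex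
  points. Construction: a basic open `D(φ) ⊆ O` with `φ ≠ 0`; the integral affine scheme
  `H = Spec Γ(T)[λ, μ]/(λ² − λ − φμ) → T` (a domain: `TwoCharts.isDomain_adjoinRoot_quad`, by the
  embedding `λ ↦ L, μ ↦ φ⁻¹(L² − L)` into `Frac(Γ(T))[L]`); on `H` the locus `φ = 0` is the disjoint
  union of the closed sets `C₀ = {φ = λ = 0}` and `C₁ = {φ = 0, λ = 1}` (`λ(λ − 1) = φμ`), so the
  opens `H_A = H|_A ∖ C₁`, `H_B = H|_B ∖ C₀` meet inside `H|_{D(φ)}`, where `α ∘ π = β ∘ π`; the two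
  morphisms glue (`TwoCharts.exists_glue_two`, Mathlib `Scheme.Cover.glueMorphisms`) to
  `S = H_A ∪ H_B → X`, and the complex points `(z_a, λ = 0, μ = 0)`, `(z_b, λ = 1, μ = 0)` work.
* `TwoCharts.exists_smoothCurve_through_two_charts` — hence a smooth irreducible affine curve maps
  to `X` through `α(z_a)` and `β(z_b)` (`mumford_smoothCurve_through_two_points_of_isSeparated` on
  `S`); `…_of_isAffineOpen` — the same for any integral `T` locally of finite type, the two points
  lying over a common affine open of `T`.

Consumer: the non-separated two-point lemma (`Motives/CurveThroughTwoPointsNonSeparated`: the two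
charts are the projections of the closure of `U ∩ V ↪ Ū × V̄` for affine opens `U ∋ a`, `V ∋ b`
with projective compactifications), wanted by the Mumford–Tate-family typing of
`Summits/HodgeConjecture/…/Ring2HypothesesMTAnchors*` (bases smooth and irreducible, not separated).

## References

* [MumfordAV1970] D. Mumford, Abelian Varieties, TIFR Studies in Math. 5, OUP 1970, §6, Lemma.
* [Hartshorne1977] R. Hartshorne, Algebraic Geometry, GTM 52 (1977), II Thm. 3.3 Step 3 and
  II Ex. 2.12 (gluing morphisms and schemes along opens).
-/

noncomputable section

open CategoryTheory CategoryTheory.Limits AlgebraicGeometry TopologicalSpace Polynomial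

namespace Literature.AlgebraicGeometry.Motives

namespace TwoCharts

universe u

/-! ### §1 Algebra: `R[λ, μ]/(λ² − λ − φ μ)` is a domain of finite type -/

section Algebra

variable {R : Type*} [CommRing R]

/-- The quadratic `λ² − λ − φ·μ ∈ R[μ][λ]` (outer variable `λ`, inner variable `μ`). -/
local notation3 "QD(" φ ")" =>
  ((Polynomial.X : Polynomial (Polynomial _)) ^ 2 - Polynomial.X - Polynomial.C (Polynomial.C φ * Polynomial.X))

/-- `deg_λ (λ² − λ) = 2`. [folklore] -/
private theorem degree_X_sq_sub_X [Nontrivial R] : ((X : (R[X])[X]) ^ 2 - X).degree = 2 := by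
  rw [degree_sub_eq_left_of_degree_lt] <;> rw [degree_X_pow]
  · rfl
  · rw [degree_X]; norm_num

/-- `λ² − λ − φμ` is monic in `λ`. [folklore] -/
private theorem quad_monic [Nontrivial R] (φ : R) : (QD(φ) : (R[X])[X]).Monic := by
  have h1 : (X ^ 2 - X : (R[X])[X]).Monic :=
    (monic_X_pow 2).sub_of_left (by rw [degree_X_pow, degree_X]; norm_num)
  refine h1.sub_of_left (lt_of_le_of_lt degree_C_le ?_)
  rw [degree_X_sq_sub_X]
  norm_num

/-- `deg_λ (λ² − λ − φμ) = 2`. [folklore] -/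
private theorem degree_quad [Nontrivial R] (φ : R) : (QD(φ) : (R[X])[X]).degree = 2 := by
  rw [degree_sub_eq_left_of_degree_lt] <;> rw [degree_X_sq_sub_X]
  exact lt_of_le_of_lt degree_C_le (by norm_num)

/-- Evaluating `λ² − λ − φμ`. [folklore] -/
private theorem eval₂_quad {S : Type*} [CommRing S] (φ : R) (i : Polynomial R →+* S) (x : S) :
    (QD(φ) : (R[X])[X]).eval₂ i x = x ^ 2 - x - i (C φ * X) := by
  rw [eval₂_sub, eval₂_sub, eval₂_X_pow, eval₂_X, eval₂_C]

section Domain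

variable [IsDomain R] {φ : R}

/-- **`R[λ, μ]/(λ² − λ − φμ)` is a domain** for a domain `R` and `φ ≠ 0`: the substitution
`λ ↦ L`, `μ ↦ φ⁻¹(L² − L)` embeds it into `K[L]`, `K = Frac R` (injectivity: reduce modulo the
monic quadratic and compare parities of `L`-degrees). [folklore] -/
private theorem isDomain_adjoinRoot_quad (hφ : φ ≠ 0) : IsDomain (AdjoinRoot (QD(φ) : (R[X])[X])) := by
  classical
  let K := FractionRing R
  have hinj : Function.Injective (algebraMap R K) := IsFractionRing.injective R K
  have hc : algebraMap R K φ ≠ 0 := (map_ne_zero_iff _ hinj).mpr hφ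
  -- `M = φ⁻¹ (L² − L)`, of degree `2`
  let M : K[X] := C (algebraMap R K φ)⁻¹ * (X ^ 2 - X)
  have hM : M.natDegree = 2 := by
    change (C (algebraMap R K φ)⁻¹ * ((X : K[X]) ^ 2 - X)).natDegree = 2
    rw [natDegree_C_mul (inv_ne_zero hc), natDegree_sub_eq_left_of_natDegree_lt] <;>
      rw [natDegree_X_pow]
    rw [natDegree_X]; norm_num
  -- the substitution `R[μ] → K[L]`
  let i : Polynomial R →+* K[X] := eval₂RingHom (C.comp (algebraMap R K)) M
  have hi : ∀ p : R[X], i p = (p.map (algebraMap R K)).comp M := fun p => by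
    change p.eval₂ (C.comp (algebraMap R K)) M = _
    rw [comp, eval₂_map]
  have hdeg : ∀ p : R[X], (i p).natDegree = 2 * p.natDegree := fun p => by
    rw [hi, natDegree_comp, hM, natDegree_map_eq_of_injective hinj, mul_comm]
  have hzero : ∀ p : R[X], i p = 0 → p = 0 := fun p h => by
    rw [hi, comp_eq_zero_iff] at h
    rcases h with h | ⟨-, h⟩
    · exact (Polynomial.map_eq_zero_iff hinj).mp h
    · have h2 := congrArg natDegree h
      rw [hM, natDegree_C] at h2
      exact absurd h2 (by norm_num)
  have hroot : (QD(φ) : (R[X])[X]).eval₂ i X = 0 := by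
    rw [eval₂_quad, map_mul]
    change (X : K[X]) ^ 2 - X - (C φ : R[X]).eval₂ (C.comp (algebraMap R K)) M *
      (X : R[X]).eval₂ (C.comp (algebraMap R K)) M = 0
    rw [eval₂_C, eval₂_X, RingHom.coe_comp, Function.comp_apply]
    change (X : K[X]) ^ 2 - X - C (algebraMap R K φ) * (C (algebraMap R K φ)⁻¹ * (X ^ 2 - X)) = 0
    rw [← mul_assoc, ← C_mul, mul_inv_cancel₀ hc, C_1, one_mul, sub_self]
  let ψ : AdjoinRoot (QD(φ) : (R[X])[X]) →+* K[X] := AdjoinRoot.lift i X hroot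
  refine Function.Injective.isDomain ψ ((injective_iff_map_eq_zero ψ).mpr fun g hg => ?_)
  induction g using AdjoinRoot.induction_on with
  | ih p =>
  have hmonic := quad_monic (R := R) φ
  rw [AdjoinRoot.lift_mk] at hg
  set r := p %ₘ QD(φ) with hr
  have hpr : AdjoinRoot.mk (QD(φ) : (R[X])[X]) p = AdjoinRoot.mk QD(φ) r := by
    rw [hr, AdjoinRoot.mk_eq_mk, sub_eq_of_eq_add' (modByMonic_add_div p QD(φ)).symm]
    exact dvd_mul_right _ _
  have hr0 : r.eval₂ i X = 0 := by
    rw [← AdjoinRoot.lift_mk hroot (g := r), ← hpr, AdjoinRoot.lift_mk, hg]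
  have hdeg1 : r.degree ≤ 1 := by
    have := degree_modByMonic_lt p hmonic
    rw [degree_quad] at this
    rw [hr]
    exact Order.le_of_lt_succ (by exact_mod_cast this)
  have hr' : r = C (r.coeff 1) * X + C (r.coeff 0) := eq_X_add_C_of_degree_le_one hdeg1
  rw [hr', eval₂_add, eval₂_mul, eval₂_C, eval₂_X, eval₂_C] at hr0
  -- parity: `i (r₁) * L` has odd degree, `i (r₀)` even degree
  have h1 : i (r.coeff 1) = 0 := by
    by_contra hne
    have hd1 : (i (r.coeff 1) * X).natDegree = 2 * (r.coeff 1).natDegree + 1 := by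
      rw [natDegree_mul hne X_ne_zero, natDegree_X, hdeg]
    have heq : i (r.coeff 1) * X = -i (r.coeff 0) := eq_neg_of_add_eq_zero_left hr0
    have hd0 : (i (r.coeff 1) * X).natDegree = 2 * (r.coeff 0).natDegree := by
      rw [heq, natDegree_neg, hdeg]
    omega
  rw [h1, zero_mul, zero_add] at hr0
  have hrz : r = 0 := by rw [hr', hzero _ h1, hzero _ hr0, C_0, zero_mul, zero_add]
  rw [hpr, hrz, map_zero]

end Domain

/-- `R[λ, μ]/(λ² − λ − φμ)` is an `R`-algebra of finite type. [folklore] -/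
private theorem finiteType_adjoinRoot_quad (φ : R) : Algebra.FiniteType R (AdjoinRoot (QD(φ) : (R[X])[X])) := by
  haveI : Algebra.FiniteType R (Polynomial (Polynomial R)) :=
    (inferInstance : Algebra.FiniteType R (Polynomial R)).trans inferInstance
  exact Algebra.FiniteType.of_surjective
    (Ideal.Quotient.mkₐ R (Ideal.span {(QD(φ) : (R[X])[X])}) :
      Polynomial (Polynomial R) →ₐ[R] AdjoinRoot (QD(φ) : (R[X])[X]))
    (Ideal.Quotient.mkₐ_surjective R _)

/-- In `R[λ, μ]/(λ² − λ − φμ)` a prime containing `φ` contains `λ` or `λ − 1`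
(`λ(λ − 1) = φμ`). [folklore] -/
private theorem root_mem_or_root_sub_one_mem (φ : R) (q : Ideal (AdjoinRoot (QD(φ) : (R[X])[X])))
    [q.IsPrime] (h : algebraMap R _ φ ∈ q) :
    AdjoinRoot.root (QD(φ) : (R[X])[X]) ∈ q ∨ AdjoinRoot.root (QD(φ) : (R[X])[X]) - 1 ∈ q := by
  apply Ideal.IsPrime.mem_or_mem ‹_›
  have hrel := AdjoinRoot.eval₂_root (QD(φ) : (R[X])[X])
  rw [eval₂_quad, sub_eq_zero,
    show AdjoinRoot.of (QD(φ) : (R[X])[X]) (C φ * X) =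
      AdjoinRoot.of (QD(φ) : (R[X])[X]) (C φ) * AdjoinRoot.of (QD(φ) : (R[X])[X]) X from
      map_mul _ _ _] at hrel
  have hC : AdjoinRoot.of (QD(φ) : (R[X])[X]) (C φ) = algebraMap R _ φ := by
    rw [IsScalarTower.algebraMap_apply R R[X] (AdjoinRoot (QD(φ) : (R[X])[X])),
      Polynomial.algebraMap_eq, AdjoinRoot.algebraMap_eq]
  rw [mul_sub, mul_one, ← sq, hrel, hC]
  exact q.mul_mem_right _ h

/-- Points of `R[λ, μ]/(λ² − λ − φμ)` with values in a ring `S`: a ring map `χ : R → S` extends to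
`R[λ, μ]/(λ² − λ − φμ) → S` with `μ ↦ 0` and `λ ↦ ℓ` for any idempotent `ℓ` (`ℓ² − ℓ = φ·0`). [folklore] -/
private theorem exists_ringHom_adjoinRoot_quad {S : Type*} [CommRing S] (φ : R) (χ : R →+* S) (ℓ : S)
    (hℓ : ℓ * ℓ = ℓ) :
    ∃ χ' : AdjoinRoot (QD(φ) : (R[X])[X]) →+* S,
      χ'.comp (algebraMap R _) = χ ∧ χ' (AdjoinRoot.root (QD(φ) : (R[X])[X])) = ℓ := by
  have h0 : (QD(φ) : (R[X])[X]).eval₂ (eval₂RingHom χ (0 : S)) ℓ = 0 := by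
    rw [eval₂_quad, map_mul, coe_eval₂RingHom, eval₂_X, mul_zero, sub_zero, sq, hℓ, sub_self]
  refine ⟨AdjoinRoot.lift (eval₂RingHom χ 0) ℓ h0, ?_, AdjoinRoot.lift_root h0⟩
  ext s
  rw [RingHom.comp_apply, IsScalarTower.algebraMap_apply R R[X], Polynomial.algebraMap_eq,
    AdjoinRoot.algebraMap_eq, AdjoinRoot.lift_of, coe_eval₂RingHom, eval₂_C]

end Algebra

/-! ### §2 Gluing two morphisms along a common restriction -/

section Glue

variable {H Y : Scheme.{u}}

/-- Two morphisms `p₁ : Z → U`, `p₂ : Z → V` into opens `U, V ⊆ H` with the same composite to `H`,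
followed by `a : U → Y`, `b : V → Y` which both restrict to `c : W → Y` on `W ⊇ U ∩ V`, have the
same composite to `Y`. [folklore] -/
private theorem comp_eq_comp_of_restrict_eq {Z : Scheme.{u}} (U V W : H.Opens) (hW : U ⊓ V ≤ W)
    (a : (U : Scheme.{u}) ⟶ Y) (b : (V : Scheme.{u}) ⟶ Y) (c : (W : Scheme.{u}) ⟶ Y)
    (ha : H.homOfLE (inf_le_left : U ⊓ W ≤ U) ≫ a = H.homOfLE inf_le_right ≫ c)
    (hb : H.homOfLE (inf_le_left : V ⊓ W ≤ V) ≫ b = H.homOfLE inf_le_right ≫ c)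
    (p₁ : Z ⟶ U) (p₂ : Z ⟶ V) (hp : p₁ ≫ U.ι = p₂ ≫ V.ι) : p₁ ≫ a = p₂ ≫ b := by
  have hpt : ∀ z : Z, (U.ι (p₁ z) : H) = V.ι (p₂ z) := fun z => by
    have := congr($hp z)
    simpa only [Scheme.Hom.comp_base, TopCat.hom_comp, ContinuousMap.comp_apply] using this
  have hmem : ∀ z : Z, (U.ι (p₁ z) : H) ∈ W := fun z =>
    hW ⟨(p₁ z).2, by rw [hpt]; exact (p₂ z).2⟩
  have h₁ : Set.range p₁ ⊆ (H.homOfLE (inf_le_left : U ⊓ W ≤ U)).opensRange := by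
    rintro _ ⟨z, rfl⟩
    rw [Scheme.opensRange_homOfLE]
    exact ⟨(p₁ z).2, hmem z⟩
  have h₂ : Set.range p₂ ⊆ (H.homOfLE (inf_le_left : V ⊓ W ≤ V)).opensRange := by
    rintro _ ⟨z, rfl⟩
    rw [Scheme.opensRange_homOfLE]
    refine ⟨(p₂ z).2, ?_⟩
    change (V.ι (p₂ z) : H) ∈ W
    rw [← hpt]
    exact hmem z
  have hq₁ := IsOpenImmersion.lift_fac _ _ h₁
  have hq₂ := IsOpenImmersion.lift_fac _ _ h₂
  have key : IsOpenImmersion.lift _ _ h₁ ≫ H.homOfLE (inf_le_right : U ⊓ W ≤ W) =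
      IsOpenImmersion.lift _ _ h₂ ≫ H.homOfLE (inf_le_right : V ⊓ W ≤ W) := by
    rw [← cancel_mono W.ι, Category.assoc, Category.assoc, Scheme.homOfLE_ι, Scheme.homOfLE_ι,
      ← Scheme.homOfLE_ι H (inf_le_left : U ⊓ W ≤ U), ← Scheme.homOfLE_ι H (inf_le_left : V ⊓ W ≤ V),
      reassoc_of% hq₁, reassoc_of% hq₂, hp]
  rw [← hq₁, ← hq₂, Category.assoc, Category.assoc, ha, hb, reassoc_of% key]

/-- **Gluing two morphisms.** Morphisms `a : U → Y`, `b : V → Y` on two opens of a scheme `H` which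
both restrict to a third morphism `c : W → Y` on an open `W ⊇ U ∩ V` glue to a morphism
`U ∪ V → Y` restricting to `a` and `b` (Mathlib `Scheme.Cover.glueMorphisms` for the cover of
`U ∪ V` by `U`, `V`). [folklore] -/
private theorem exists_glue_two (U V W : H.Opens) (hW : U ⊓ V ≤ W) (a : (U : Scheme.{u}) ⟶ Y)
    (b : (V : Scheme.{u}) ⟶ Y) (c : (W : Scheme.{u}) ⟶ Y)
    (ha : H.homOfLE (inf_le_left : U ⊓ W ≤ U) ≫ a = H.homOfLE inf_le_right ≫ c)
    (hb : H.homOfLE (inf_le_left : V ⊓ W ≤ V) ≫ b = H.homOfLE inf_le_right ≫ c) :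
    ∃ γ : ((U ⊔ V : H.Opens) : Scheme.{u}) ⟶ Y,
      H.homOfLE (le_sup_left : U ≤ U ⊔ V) ≫ γ = a ∧ H.homOfLE (le_sup_right : V ≤ U ⊔ V) ≫ γ = b := by
  let obj : Bool → Scheme.{u} := fun i =>
    match i with
    | true => (U : Scheme.{u})
    | false => (V : Scheme.{u})
  let map : ∀ i, obj i ⟶ ((U ⊔ V : H.Opens) : Scheme.{u}) := fun i =>
    match i with
    | true => H.homOfLE le_sup_left
    | false => H.homOfLE le_sup_right
  have hcov : ∀ x : ((U ⊔ V : H.Opens) : Scheme.{u}), ∃ i y, map i y = x := by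
    rintro ⟨x, hx⟩
    rcases Opens.mem_sup.mp hx with h | h
    · exact ⟨true, ⟨x, h⟩, Scheme.homOfLE_apply' _ x h⟩
    · exact ⟨false, ⟨x, h⟩, Scheme.homOfLE_apply' _ x h⟩
  have hprop : ∀ i, IsOpenImmersion (map i) := by
    rintro (_ | _)
    · exact inferInstanceAs (IsOpenImmersion (H.homOfLE _))
    · exact inferInstanceAs (IsOpenImmersion (H.homOfLE _))
  let 𝒰 : ((U ⊔ V : H.Opens) : Scheme.{u}).OpenCover :=
    Scheme.Cover.mkOfCovers Bool obj map hcov hprop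
  let f : ∀ i, obj i ⟶ Y := fun i =>
    match i with
    | true => a
    | false => b
  have hf' : ∀ i j : Bool, pullback.fst (map i) (map j) ≫ f i = pullback.snd _ _ ≫ f j := by
    have hU : U.ι = H.homOfLE (le_sup_left : U ≤ U ⊔ V) ≫ (U ⊔ V).ι := (Scheme.homOfLE_ι _ _).symm
    have hV : V.ι = H.homOfLE (le_sup_right : V ≤ U ⊔ V) ≫ (U ⊔ V).ι := (Scheme.homOfLE_ι _ _).symm
    rintro (_ | _) (_ | _)
    · show pullback.fst (H.homOfLE _) (H.homOfLE _) ≫ b = pullback.snd (H.homOfLE _) (H.homOfLE _) ≫ b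
      rw [fst_eq_snd_of_mono_eq]
    · show pullback.fst (H.homOfLE _) (H.homOfLE _) ≫ b = pullback.snd (H.homOfLE _) (H.homOfLE _) ≫ a
      symm
      refine comp_eq_comp_of_restrict_eq U V W hW a b c ha hb _ _ ?_
      rw [hU, hV, pullback.condition_assoc]
    · show pullback.fst (H.homOfLE _) (H.homOfLE _) ≫ a = pullback.snd (H.homOfLE _) (H.homOfLE _) ≫ b
      refine comp_eq_comp_of_restrict_eq U V W hW a b c ha hb _ _ ?_
      rw [hU, hV, pullback.condition_assoc]
    · show pullback.fst (H.homOfLE _) (H.homOfLE _) ≫ a = pullback.snd (H.homOfLE _) (H.homOfLE _) ≫ a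
      rw [fst_eq_snd_of_mono_eq]
  have hf : ∀ i j, pullback.fst (𝒰.f i) (𝒰.f j) ≫ f i = pullback.snd _ _ ≫ f j := fun i j => hf' i j
  exact ⟨𝒰.glueMorphisms f hf, 𝒰.ι_glueMorphisms f hf true, 𝒰.ι_glueMorphisms f hf false⟩

/-- Morphisms out of `U ∪ V` are determined by their restrictions to `U` and `V`
(Mathlib `hom_ext_of_forall`). [folklore] -/
private theorem hom_ext_two (U V : H.Opens) (γ₁ γ₂ : ((U ⊔ V : H.Opens) : Scheme.{u}) ⟶ Y)
    (h₁ : H.homOfLE (le_sup_left : U ≤ U ⊔ V) ≫ γ₁ = H.homOfLE (le_sup_left : U ≤ U ⊔ V) ≫ γ₂)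
    (h₂ : H.homOfLE (le_sup_right : V ≤ U ⊔ V) ≫ γ₁ = H.homOfLE (le_sup_right : V ≤ U ⊔ V) ≫ γ₂) :
    γ₁ = γ₂ := by
  -- the inclusion of the open `(U ⊔ V).ι⁻¹ U'` of `U ⊔ V` factors through `homOfLE`
  have key : ∀ {U' : H.Opens} (e : U' ≤ U ⊔ V), H.homOfLE e ≫ γ₁ = H.homOfLE e ≫ γ₂ →
      ((U ⊔ V).ι ⁻¹ᵁ U').ι ≫ γ₁ = ((U ⊔ V).ι ⁻¹ᵁ U').ι ≫ γ₂ := by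
    intro U' e h
    have hr : Set.range ((U ⊔ V).ι ⁻¹ᵁ U').ι = Set.range (H.homOfLE e) := by
      rw [Scheme.Opens.range_ι, ← Scheme.Hom.coe_opensRange, Scheme.opensRange_homOfLE]
    rw [← IsOpenImmersion.isoOfRangeEq_hom_fac _ _ hr, Category.assoc, Category.assoc, h]
  refine Scheme.hom_ext_of_forall _ _ fun x => ?_
  rcases Opens.mem_sup.mp x.2 with hx | hx
  · exact ⟨(U ⊔ V).ι ⁻¹ᵁ U, hx, key le_sup_left h₁⟩
  · exact ⟨(U ⊔ V).ι ⁻¹ᵁ V, hx, key le_sup_right h₂⟩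

end Glue

/-! ### §3 Two charts of a possibly non-separated scheme -/

section Main

/-- The quadratic `λ² − λ − φ·μ ∈ R[μ][λ]` (outer variable `λ`, inner variable `μ`). -/
local notation3 "QD(" φ ")" =>
  ((Polynomial.X : Polynomial (Polynomial _)) ^ 2 - Polynomial.X - Polynomial.C (Polynomial.C φ * Polynomial.X))

set_option maxHeartbeats 400000 in
/-- **Two charts.** Let `T` be an affine integral `ℂ`-scheme of finite type, `A, B ⊆ T` opens,
`O ⊆ A ∩ B` a non-empty open, and `α : A → X`, `β : B → X` two `ℂ`-morphisms to a `ℂ`-scheme `X`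
(possibly NON-SEPARATED) which agree on `O`. Then for complex points `z_a ∈ A(ℂ)`, `z_b ∈ B(ℂ)`
there is an INTEGRAL SEPARATED `ℂ`-scheme `S` of finite type with a `ℂ`-morphism `γ : S → X` and two
DISTINCT complex points of `S` over `α(z_a)` and `β(z_b)`. Construction: choose a basic open
`D(φ) ⊆ O`, `φ ≠ 0`; on `H = Spec Γ(T)[λ, μ]/(λ² − λ − φμ) → T` (integral) the locus `φ = 0` splits
into the disjoint closed sets `C₀ = {φ = 0, λ = 0}` and `C₁ = {φ = 0, λ = 1}`; the opens
`H_A = H|_A ∖ C₁` and `H_B = H|_B ∖ C₀` meet inside `H|_{D(φ)}`, where `α ∘ π = β ∘ π`, so these glue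
to `γ : S = H_A ∪ H_B → X`; the points `(z_a, λ = 0, μ = 0) ∈ H_A` and `(z_b, λ = 1, μ = 0) ∈ H_B`
work. [folklore] -/
private theorem exists_isSeparated_through_two_charts {X T : SchemeOver ℂ} [IsAffine T.left]
    [IsIntegral T.left] [LocallyOfFiniteType T.hom] [LocallyOfFiniteType X.hom]
    (A B O : T.left.Opens) (hOA : O ≤ A) (hOB : O ≤ B) (hO : (O : Set T.left).Nonempty)
    (α : openSubschemeOver T A ⟶ X) (β : openSubschemeOver T B ⟶ X)
    (hαβ : T.left.homOfLE hOA ≫ α.left = T.left.homOfLE hOB ≫ β.left)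
    (za : ComplexPoints (openSubschemeOver T A)) (zb : ComplexPoints (openSubschemeOver T B)) :
    ∃ (S : SchemeOver ℂ) (γ : S ⟶ X) (a b : ComplexPoints S),
      IsIntegral S.left ∧ IsSeparated S.hom ∧ LocallyOfFiniteType S.hom ∧ a ≠ b ∧
        AlgPoints.map γ a = AlgPoints.map α za ∧ AlgPoints.map γ b = AlgPoints.map β zb := by
  classical
  /- Step 0: Scheme-level names for the data; a non-zero `φ` with `D(φ) ⊆ O`. -/
  obtain ⟨α₀, hα₀⟩ : ∃ α₀ : (A : Scheme) ⟶ X.left, α₀ = α.left := ⟨_, rfl⟩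
  obtain ⟨β₀, hβ₀⟩ : ∃ β₀ : (B : Scheme) ⟶ X.left, β₀ = β.left := ⟨_, rfl⟩
  have hαw : α₀ ≫ X.hom = A.ι ≫ T.hom := by rw [hα₀]; exact Over.w α
  have hβw : β₀ ≫ X.hom = B.ι ≫ T.hom := by rw [hβ₀]; exact Over.w β
  have hαβ₀ : T.left.homOfLE hOA ≫ α₀ = T.left.homOfLE hOB ≫ β₀ := by rw [hα₀, hβ₀]; exact hαβ
  obtain ⟨pza, hpza⟩ : ∃ p : Spec (.of ℂ) ⟶ (A : Scheme), p = za.left := ⟨_, rfl⟩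
  obtain ⟨pzb, hpzb⟩ : ∃ p : Spec (.of ℂ) ⟶ (B : Scheme), p = zb.left := ⟨_, rfl⟩
  have hwza : pza ≫ A.ι ≫ T.hom = (specOver ℂ ℂ).hom := by rw [hpza]; exact Over.w za
  have hwzb : pzb ≫ B.ι ≫ T.hom = (specOver ℂ ℂ).hom := by rw [hpzb]; exact Over.w zb
  let ya : (A : Scheme) := pza (IsLocalRing.closedPoint ℂ)
  let yb : (B : Scheme) := pzb (IsLocalRing.closedPoint ℂ)
  have hya : (AlgPoints.map α za).pt = α₀ ya := by rw [hα₀]; simp only [ya, hpza]; rfl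
  have hyb : (AlgPoints.map β zb).pt = β₀ yb := by rw [hβ₀]; simp only [yb, hpzb]; rfl
  obtain ⟨x, hx⟩ := hO
  obtain ⟨_, ⟨φ, rfl⟩, hxφ, hφO⟩ := (Opens.isBasis_iff_nbhd.mp (isBasis_basicOpen T.left)) hx
  have hφ : φ ≠ 0 := by
    rintro rfl
    rw [Scheme.basicOpen_zero] at hxφ
    exact hxφ
  /- Step 1: the auxiliary affine scheme `H = Spec Γ(T)[λ, μ]/(λ² − λ − φμ) → T`. -/
  let R : Type := Γ(T.left, ⊤)
  let Rq : Type := AdjoinRoot (QD(φ) : (R[X])[X])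
  haveI : IsDomain Rq := isDomain_adjoinRoot_quad hφ
  let ι₁ : Γ(T.left, ⊤) ⟶ CommRingCat.of Rq := CommRingCat.ofHom (algebraMap R Rq)
  let H : Scheme := Spec (CommRingCat.of Rq)
  let e := T.left.isoSpec
  let πH : H ⟶ T.left := Spec.map ι₁ ≫ e.inv
  let φ' : Rq := algebraMap R Rq φ
  let rt : Rq := AdjoinRoot.root (QD(φ) : (R[X])[X])
  -- the disjoint closed subsets `C₀ = {φ = 0, λ = 0}`, `C₁ = {φ = 0, λ = 1}` of `H`
  let C₀ : Set H := PrimeSpectrum.zeroLocus {φ', rt}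
  let C₁ : Set H := PrimeSpectrum.zeroLocus {φ', rt - 1}
  have hC₀ : IsClosed C₀ := PrimeSpectrum.isClosed_zeroLocus _
  have hC₁ : IsClosed C₁ := PrimeSpectrum.isClosed_zeroLocus _
  let HA : H.Opens := πH ⁻¹ᵁ A ⊓ ⟨C₁ᶜ, hC₁.isOpen_compl⟩
  let HB : H.Opens := πH ⁻¹ᵁ B ⊓ ⟨C₀ᶜ, hC₀.isOpen_compl⟩
  let HO : H.Opens := πH ⁻¹ᵁ T.left.basicOpen φ
  /- Step 2: `H_A ∩ H_B ⊆ H|_{D(φ)}` since `λ(λ − 1) = φμ`. -/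
  have hpre : ∀ q : H, q ∈ HO ↔ φ' ∉ q.asIdeal := fun q => by
    change πH q ∈ T.left.basicOpen φ ↔ _
    rw [← Scheme.map_PrimeSpectrum_basicOpen_of_affine]
    change e.hom (πH q) ∈ PrimeSpectrum.basicOpen φ ↔ _
    rw [Scheme.Hom.comp_apply, Scheme.inv_hom_apply, Spec.map_apply]
    exact Iff.rfl
  have hAB : HA ⊓ HB ≤ HO := by
    rintro q ⟨⟨-, hq₁⟩, ⟨-, hq₀⟩⟩
    refine (hpre q).mpr fun hφq => ?_
    rcases root_mem_or_root_sub_one_mem φ q.asIdeal hφq with h | h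
    · exact hq₀ ((PrimeSpectrum.mem_zeroLocus _ _).mpr
        (Set.insert_subset_iff.mpr ⟨hφq, Set.singleton_subset_iff.mpr h⟩))
    · exact hq₁ ((PrimeSpectrum.mem_zeroLocus _ _).mpr
        (Set.insert_subset_iff.mpr ⟨hφq, Set.singleton_subset_iff.mpr h⟩))
  /- Step 3: the morphisms `H_A → X`, `H_B → X` and their common restriction to `H|_{D(φ)}`. -/
  have hOle : HO ≤ πH ⁻¹ᵁ O := Scheme.Hom.preimage_mono πH hφO
  let a : (HA : Scheme) ⟶ X.left := πH.resLE A HA inf_le_left ≫ α₀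
  let b : (HB : Scheme) ⟶ X.left := πH.resLE B HB inf_le_left ≫ β₀
  let c : (HO : Scheme) ⟶ X.left := πH.resLE O HO hOle ≫ T.left.homOfLE hOA ≫ α₀
  have ha : H.homOfLE (inf_le_left : HA ⊓ HO ≤ HA) ≫ a = H.homOfLE inf_le_right ≫ c := by
    simp only [a, c, Scheme.Hom.map_resLE_assoc, Scheme.Hom.resLE_map_assoc]
  have hb : H.homOfLE (inf_le_left : HB ⊓ HO ≤ HB) ≫ b = H.homOfLE inf_le_right ≫ c := by
    simp only [b, c, Scheme.Hom.map_resLE_assoc]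
    rw [hαβ₀]
    simp only [Scheme.Hom.resLE_map_assoc]
  /- Step 4: glue. -/
  obtain ⟨γ, hγa, hγb⟩ := exists_glue_two HA HB HO hAB a b c ha hb
  have hγ : γ ≫ X.hom = (HA ⊔ HB).ι ≫ πH ≫ T.hom := by
    refine hom_ext_two HA HB _ _ ?_ ?_
    · rw [reassoc_of% hγa, Scheme.homOfLE_ι_assoc]
      simp only [a, Category.assoc]
      rw [hαw, Scheme.Hom.resLE_comp_ι_assoc]
    · rw [reassoc_of% hγb, Scheme.homOfLE_ι_assoc]
      simp only [b, Category.assoc]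
      rw [hβw, Scheme.Hom.resLE_comp_ι_assoc]
  let Hₒ : SchemeOver ℂ := Over.mk (πH ≫ T.hom)
  let Sₒ : SchemeOver ℂ := openSubschemeOver Hₒ (HA ⊔ HB)
  let γₒ : Sₒ ⟶ X := Over.homMk γ hγ
  /- Step 5: complex points of `H` over `z_a`, `z_b`: `Γ(T) → ℂ` extended by `λ ↦ ℓ`, `μ ↦ 0`. -/
  have hpt : ∀ (U : T.left.Opens) (p : Spec (.of ℂ) ⟶ (U : Scheme)) (ℓ : ℂ), ℓ * ℓ = ℓ →
      ∃ χ' : Rq →+* ℂ, χ' rt = ℓ ∧ Spec.map (CommRingCat.ofHom χ') ≫ πH = p ≫ U.ι := by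
    intro U p ℓ hℓ
    let χ : Γ(T.left, ⊤) ⟶ CommRingCat.of ℂ := Spec.preimage (p ≫ U.ι ≫ e.hom)
    obtain ⟨χ', h₁, h₂⟩ := exists_ringHom_adjoinRoot_quad φ χ.hom ℓ hℓ
    refine ⟨χ', h₂, ?_⟩
    have hι : ι₁ ≫ CommRingCat.ofHom χ' = χ := by
      rw [← CommRingCat.ofHom_hom χ, ← h₁, CommRingCat.ofHom_comp]
    change Spec.map _ ≫ Spec.map ι₁ ≫ e.inv = _
    rw [← Spec.map_comp_assoc, hι, Spec.map_preimage, Category.assoc, Category.assoc,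
      Iso.hom_inv_id, Category.comp_id]
  obtain ⟨χa, hχa, hfa⟩ := hpt A pza 0 (mul_zero 0)
  obtain ⟨χb, hχb, hfb⟩ := hpt B pzb 1 (mul_one 1)
  -- the two points of `H` and the primes they correspond to
  let xa : H := Spec.map (CommRingCat.ofHom χa) (IsLocalRing.closedPoint ℂ)
  let xb : H := Spec.map (CommRingCat.ofHom χb) (IsLocalRing.closedPoint ℂ)
  have hmem : ∀ (χ' : Rq →+* ℂ) (s : Rq),
      s ∈ (Spec.map (CommRingCat.ofHom χ') (IsLocalRing.closedPoint ℂ)).asIdeal ↔ χ' s = 0 := by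
    intro χ' s
    rw [Spec.map_apply, PrimeSpectrum.comap_asIdeal, Ideal.mem_comap, CommRingCat.hom_ofHom]
    change χ' s ∈ IsLocalRing.maximalIdeal ℂ ↔ _
    rw [IsLocalRing.mem_maximalIdeal, mem_nonunits_iff, isUnit_iff_ne_zero, not_not]
  have hπa : πH xa = A.ι ya := by
    have h := congr($hfa (IsLocalRing.closedPoint ℂ))
    simp only [Scheme.Hom.comp_apply] at h
    exact h
  have hπb : πH xb = B.ι yb := by
    have h := congr($hfb (IsLocalRing.closedPoint ℂ))
    simp only [Scheme.Hom.comp_apply] at h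
    exact h
  have hxaA : xa ∈ HA := by
    refine ⟨show πH xa ∈ A by rw [hπa, Scheme.Opens.ι_apply]; exact ya.2, fun hC => ?_⟩
    have h1 : rt - 1 ∈ xa.asIdeal :=
      (PrimeSpectrum.mem_zeroLocus _ _).mp hC (Set.mem_insert_of_mem _ (Set.mem_singleton _))
    rw [hmem, map_sub, hχa, map_one] at h1
    norm_num at h1
  have hxbB : xb ∈ HB := by
    refine ⟨show πH xb ∈ B by rw [hπb, Scheme.Opens.ι_apply]; exact yb.2, fun hC => ?_⟩
    have h1 : rt ∈ xb.asIdeal :=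
      (PrimeSpectrum.mem_zeroLocus _ _).mp hC (Set.mem_insert_of_mem _ (Set.mem_singleton _))
    rw [hmem, hχb] at h1
    exact one_ne_zero h1
  have hne : xa ≠ xb := by
    intro h
    have h1 : rt ∈ xa.asIdeal := by rw [hmem, hχa]
    rw [h, hmem, hχb] at h1
    exact one_ne_zero h1
  -- as complex points of `Hₒ`
  have wa : Spec.map (CommRingCat.ofHom χa) ≫ Hₒ.hom = (specOver ℂ ℂ).hom := by
    change Spec.map (CommRingCat.ofHom χa) ≫ πH ≫ T.hom = _
    rw [reassoc_of% hfa, hwza]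
  have wb : Spec.map (CommRingCat.ofHom χb) ≫ Hₒ.hom = (specOver ℂ ℂ).hom := by
    change Spec.map (CommRingCat.ofHom χb) ≫ πH ≫ T.hom = _
    rw [reassoc_of% hfb, hwzb]
  let qa : ComplexPoints Hₒ :=
    Over.homMk (Spec.map (CommRingCat.ofHom χa) : (specOver ℂ ℂ).left ⟶ Hₒ.left) wa
  let qb : ComplexPoints Hₒ :=
    Over.homMk (Spec.map (CommRingCat.ofHom χb) : (specOver ℂ ℂ).left ⟶ Hₒ.left) wb
  have hqa : qa.pt = xa := rfl
  have hqb : qb.pt = xb := rfl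
  /- Step 6: lift to `S = H_A ∪ H_B` and compute the images. -/
  haveI : IsOpenImmersion (openSubschemeOverι Hₒ (HA ⊔ HB)).left :=
    inferInstanceAs (IsOpenImmersion (HA ⊔ HB).ι)
  have hra : qa.pt ∈ (openSubschemeOverι Hₒ (HA ⊔ HB)).left.opensRange := by
    change xa ∈ (HA ⊔ HB).ι.opensRange
    rw [Scheme.Opens.opensRange_ι]
    exact Opens.mem_sup.mpr (Or.inl hxaA)
  have hrb : qb.pt ∈ (openSubschemeOverι Hₒ (HA ⊔ HB)).left.opensRange := by
    change xb ∈ (HA ⊔ HB).ι.opensRange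
    rw [Scheme.Opens.opensRange_ι]
    exact Opens.mem_sup.mpr (Or.inr hxbB)
  let sa := AlgPoints.liftOfMemOpensRange _ qa hra
  let sb := AlgPoints.liftOfMemOpensRange _ qb hrb
  have hsa : (sa.pt.1 : H) = xa := by
    change ((AlgPoints.map (openSubschemeOverι Hₒ (HA ⊔ HB)) sa).pt) = xa
    rw [AlgPoints.map_liftOfMemOpensRange]
    exact hqa
  have hsb : (sb.pt.1 : H) = xb := by
    change ((AlgPoints.map (openSubschemeOverι Hₒ (HA ⊔ HB)) sb).pt) = xb
    rw [AlgPoints.map_liftOfMemOpensRange]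
    exact hqb
  -- images under `γ`: computed on underlying points
  have himg_a : (AlgPoints.map γₒ sa).pt = (AlgPoints.map α za).pt := by
    rw [hya]
    change γ sa.pt = α₀ ya
    have h1 : sa.pt = H.homOfLE (le_sup_left : HA ≤ HA ⊔ HB) ⟨xa, hxaA⟩ := by
      apply Subtype.ext
      rw [hsa, Scheme.homOfLE_apply]
    have h2 : πH.resLE A HA inf_le_left ⟨xa, hxaA⟩ = ya := by
      apply Subtype.ext
      rw [Scheme.Hom.coe_resLE_apply, hπa, Scheme.Opens.ι_apply]
    rw [h1, ← Scheme.Hom.comp_apply, hγa]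
    change α₀ (πH.resLE A HA inf_le_left ⟨xa, hxaA⟩) = _
    rw [h2]
  have himg_b : (AlgPoints.map γₒ sb).pt = (AlgPoints.map β zb).pt := by
    rw [hyb]
    change γ sb.pt = β₀ yb
    have h1 : sb.pt = H.homOfLE (le_sup_right : HB ≤ HA ⊔ HB) ⟨xb, hxbB⟩ := by
      apply Subtype.ext
      rw [hsb, Scheme.homOfLE_apply]
    have h2 : πH.resLE B HB inf_le_left ⟨xb, hxbB⟩ = yb := by
      apply Subtype.ext
      rw [Scheme.Hom.coe_resLE_apply, hπb, Scheme.Opens.ι_apply]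
    rw [h1, ← Scheme.Hom.comp_apply, hγb]
    change β₀ (πH.resLE B HB inf_le_left ⟨xb, hxbB⟩) = _
    rw [h2]
  /- Step 7: the properties of `S`. -/
  haveI : LocallyOfFiniteType (Spec.map ι₁) := by
    rw [HasRingHomProperty.Spec_iff (P := @LocallyOfFiniteType)]
    exact RingHom.finiteType_algebraMap.mpr (finiteType_adjoinRoot_quad φ)
  haveI : LocallyOfFiniteType Sₒ.hom := by
    change LocallyOfFiniteType ((HA ⊔ HB).ι ≫ (Spec.map ι₁ ≫ e.inv) ≫ T.hom)
    infer_instance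
  haveI : IsSeparated Sₒ.hom := by
    change IsSeparated ((HA ⊔ HB).ι ≫ (Spec.map ι₁ ≫ e.inv) ≫ T.hom)
    infer_instance
  haveI : Nonempty ((HA ⊔ HB : H.Opens) : Scheme) := ⟨⟨xa, Opens.mem_sup.mpr (Or.inl hxaA)⟩⟩
  have hint : IsIntegral ((HA ⊔ HB : H.Opens) : Scheme) := isIntegral_of_isOpenImmersion (HA ⊔ HB).ι
  refine ⟨Sₒ, γₒ, sa, sb, hint, ‹_›, ‹_›, fun h => hne ?_, ?_, ?_⟩
  · rw [← hsa, ← hsb, h]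
  · exact (ComplexPoints.equivClosedPoints X).injective (Subtype.ext himg_a)
  · exact (ComplexPoints.equivClosedPoints X).injective (Subtype.ext himg_b)

/-- **Two charts, curve form.** In the situation of `exists_isSeparated_through_two_charts`, a smooth
irreducible affine curve maps to `X` through `α(z_a)` and `β(z_b)` (the separated two-point lemma
`mumford_smoothCurve_through_two_points_of_isSeparated` on the glued scheme `S`).
[cite: MumfordAV1970, §6, Lemma] -/
theorem exists_smoothCurve_through_two_charts {X T : SchemeOver ℂ} [IsAffine T.left]
    [IsIntegral T.left] [LocallyOfFiniteType T.hom] [LocallyOfFiniteType X.hom]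
    (A B O : T.left.Opens) (hOA : O ≤ A) (hOB : O ≤ B) (hO : (O : Set T.left).Nonempty)
    (α : openSubschemeOver T A ⟶ X) (β : openSubschemeOver T B ⟶ X)
    (hαβ : T.left.homOfLE hOA ≫ α.left = T.left.homOfLE hOB ≫ β.left)
    (za : ComplexPoints (openSubschemeOver T A)) (zb : ComplexPoints (openSubschemeOver T B)) :
    ∃ (C : SchemeOver ℂ) (g : C ⟶ X) (a' b' : ComplexPoints C),
      IsAffine C.left ∧ IrreducibleSpace C.left ∧ AlgebraicGeometry.Smooth C.hom ∧
        topologicalKrullDim C.left = 1 ∧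
        AlgPoints.map g a' = AlgPoints.map α za ∧ AlgPoints.map g b' = AlgPoints.map β zb := by
  obtain ⟨S, γ, a, b, hS, hsep, hft, hab, ha, hb⟩ :=
    exists_isSeparated_through_two_charts A B O hOA hOB hO α β hαβ za zb
  haveI := hS; haveI := hsep; haveI := hft
  obtain ⟨C, g, a', b', hC, hirr, hsm, hdim, ha', hb'⟩ :=
    mumford_smoothCurve_through_two_points_of_isSeparated a b hab
  refine ⟨C, g ≫ γ, a', b', hC, hirr, hsm, hdim, ?_, ?_⟩
  · rw [AlgPoints.map_comp_apply, ha', ha]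
  · rw [AlgPoints.map_comp_apply, hb', hb]

/-- **Two charts, curve form, for an affine open of the base.** As
`exists_smoothCurve_through_two_charts`, but `T` is any integral `ℂ`-scheme locally of finite type
and the two points are only asked to lie over a common AFFINE open `T' ⊆ T` (restrict all data to
`T'`). [cite: MumfordAV1970, §6, Lemma] -/
theorem exists_smoothCurve_through_two_charts_of_isAffineOpen {X T : SchemeOver ℂ}
    [IsIntegral T.left] [LocallyOfFiniteType T.hom] [LocallyOfFiniteType X.hom]
    (A B O : T.left.Opens) (hOA : O ≤ A) (hOB : O ≤ B) (hO : (O : Set T.left).Nonempty)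
    (α : openSubschemeOver T A ⟶ X) (β : openSubschemeOver T B ⟶ X)
    (hαβ : T.left.homOfLE hOA ≫ α.left = T.left.homOfLE hOB ≫ β.left)
    (za : ComplexPoints (openSubschemeOver T A)) (zb : ComplexPoints (openSubschemeOver T B))
    (T' : T.left.Opens) (hT' : IsAffineOpen T') (haT : A.ι za.pt ∈ T') (hbT : B.ι zb.pt ∈ T') :
    ∃ (C : SchemeOver ℂ) (g : C ⟶ X) (a' b' : ComplexPoints C),
      IsAffine C.left ∧ IrreducibleSpace C.left ∧ AlgebraicGeometry.Smooth C.hom ∧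
        topologicalKrullDim C.left = 1 ∧
        AlgPoints.map g a' = AlgPoints.map α za ∧ AlgPoints.map g b' = AlgPoints.map β zb := by
  -- the affine open `T'` as a `ℂ`-scheme and the restricted data
  let Tₒ : SchemeOver ℂ := openSubschemeOver T T'
  haveI : IsAffine Tₒ.left := hT'
  haveI : Nonempty (T' : Scheme) := ⟨⟨_, haT⟩⟩
  have hT'int : IsIntegral (T' : Scheme) := isIntegral_of_isOpenImmersion T'.ι
  haveI : IsIntegral Tₒ.left := hT'int
  haveI : LocallyOfFiniteType Tₒ.hom := by
    change LocallyOfFiniteType (T'.ι ≫ T.hom); infer_instance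
  let A' : (T' : Scheme).Opens := T'.ι ⁻¹ᵁ A
  let B' : (T' : Scheme).Opens := T'.ι ⁻¹ᵁ B
  let O' : (T' : Scheme).Opens := T'.ι ⁻¹ᵁ O
  -- the restriction maps `A' → A`, `B' → B` as `ℂ`-morphisms
  have wA : (T'.ι ∣_ A) ≫ (openSubschemeOver T A).hom = (openSubschemeOver Tₒ A').hom := by
    change (T'.ι ∣_ A) ≫ A.ι ≫ T.hom = (T'.ι ⁻¹ᵁ A).ι ≫ T'.ι ≫ T.hom
    rw [← Category.assoc, morphismRestrict_ι, Category.assoc]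
  have wB : (T'.ι ∣_ B) ≫ (openSubschemeOver T B).hom = (openSubschemeOver Tₒ B').hom := by
    change (T'.ι ∣_ B) ≫ B.ι ≫ T.hom = (T'.ι ⁻¹ᵁ B).ι ≫ T'.ι ≫ T.hom
    rw [← Category.assoc, morphismRestrict_ι, Category.assoc]
  let ρA : openSubschemeOver Tₒ A' ⟶ openSubschemeOver T A := Over.homMk (T'.ι ∣_ A) wA
  let ρB : openSubschemeOver Tₒ B' ⟶ openSubschemeOver T B := Over.homMk (T'.ι ∣_ B) wB
  have hO'A : O' ≤ A' := Scheme.Hom.preimage_mono _ hOA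
  have hO'B : O' ≤ B' := Scheme.Hom.preimage_mono _ hOB
  have hαβ' : (T' : Scheme).homOfLE hO'A ≫ (ρA ≫ α).left = (T' : Scheme).homOfLE hO'B ≫ (ρB ≫ β).left := by
    change (T' : Scheme).homOfLE hO'A ≫ (T'.ι ∣_ A) ≫ α.left =
      (T' : Scheme).homOfLE hO'B ≫ (T'.ι ∣_ B) ≫ β.left
    rw [← morphismRestrict_homOfLE_assoc T'.ι O A hOA, ← morphismRestrict_homOfLE_assoc T'.ι O B hOB, hαβ]
  -- `O'` is non-empty: `O` and `T'` are non-empty opens of the irreducible `T`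
  have hO' : (O' : Set (T' : Scheme)).Nonempty := by
    obtain ⟨t, htO, htT⟩ := nonempty_preirreducible_inter O.isOpen T'.isOpen hO ⟨_, haT⟩
    exact ⟨⟨t, htT⟩, htO⟩
  -- lift the points
  haveI : IsOpenImmersion ρA.left := inferInstanceAs (IsOpenImmersion (T'.ι ∣_ A))
  haveI : IsOpenImmersion ρB.left := inferInstanceAs (IsOpenImmersion (T'.ι ∣_ B))
  obtain ⟨ya, hya⟩ : ∃ y : (A : Scheme), y = za.pt := ⟨_, rfl⟩
  obtain ⟨yb, hyb⟩ : ∃ y : (B : Scheme), y = zb.pt := ⟨_, rfl⟩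
  have haT' : ya.1 ∈ T' := by rw [hya]; exact haT
  have hbT' : yb.1 ∈ T' := by rw [hyb]; exact hbT
  have hra : za.pt ∈ ρA.left.opensRange := by
    refine ⟨⟨⟨ya.1, haT'⟩, show ya.1 ∈ A from ya.2⟩, ?_⟩
    rw [← hya]
    apply Subtype.ext
    exact morphismRestrict_base_coe T'.ι A _
  have hrb : zb.pt ∈ ρB.left.opensRange := by
    refine ⟨⟨⟨yb.1, hbT'⟩, show yb.1 ∈ B from yb.2⟩, ?_⟩
    rw [← hyb]
    apply Subtype.ext
    exact morphismRestrict_base_coe T'.ι B _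
  let za' := AlgPoints.liftOfMemOpensRange ρA za hra
  let zb' := AlgPoints.liftOfMemOpensRange ρB zb hrb
  obtain ⟨C, g, a', b', hC, hirr, hsm, hdim, ha', hb'⟩ :=
    exists_smoothCurve_through_two_charts (T := Tₒ) A' B' O' hO'A hO'B hO' (ρA ≫ α) (ρB ≫ β)
      hαβ' za' zb'
  refine ⟨C, g, a', b', hC, hirr, hsm, hdim, ?_, ?_⟩
  · rw [ha', AlgPoints.map_comp_apply, AlgPoints.map_liftOfMemOpensRange]
  · rw [hb', AlgPoints.map_comp_apply, AlgPoints.map_liftOfMemOpensRange]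

end Main

end TwoCharts

end Literature.AlgebraicGeometry.Motives

end
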